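import Summits.QuantumFields.YangMills.Theorems.ColdStartUniversalityLatticeLangevinDuhamelIntegrated
import Summits.QuantumFields.YangMills.Theorems.ColdStartUniversalityLatticeLangevinInvariantPicard
import Summits.QuantumFields.YangMills.Theorems.ColdStartUniversalityLatticeLangevinInvariantOfKernel
import Summits.QuantumFields.YangMills.Theorems.ColdStartUniversalityLatticeLangevinRungFinal
import HarnessLib

/-!
# Route `ColdStartUniversality`, crux K_A1 `UniformColdStartMixing` (stmt-QuantumFields-24809), rung `stub_fixedCutoffMixing`:
# SZZ Lemma 3.3 for `SU(2)`, `d = 3`, EVERY coupling — the Wilson measure is invariant under the lattice Langevin dynamics;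
# the rung `stub_fixedCutoffMixing` (fixed-cut-off cold-start Cesàro mixing) unconditionally

Seat `ym-line-csu-p1`, g8.  `wilsonMeasureLangevinInvariant_su2 : WilsonMeasureLangevinInvariant (fundamentalLatticeRep 2) 3 L β'`
— the named fact (Shen–Zhu–Zhu, CMP 400 (2023), §3 Lemma 3.3) is a THEOREM of the tree for `SU(2)`, `d = 3`, all `L`, `β'`.
Proof (ground-state transform + Duhamel + Picard, no PDE regularity): with `φ̂ = e^{-ψ̂/2}`, `μ_{β'} ∝ φ̂⁻² Haar^E`
(`integral_wilsonMeasure_eq_const_mul`), the integrated Duhamel identity (`integrated_duhamel`: Dynkin for the SZZ system,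
`generator_groundState`, Haar symmetry and ridge eigen-expansion of the `β' = 0` kernels) feeds the abstract Picard step
(`integral_kernel_weighted_eq_of_duhamel`) on the ridge class (dense: `exists_ridge_uniform_near`; an algebra: `exists_ridge_mul`;
`κ⁰`-stable: `exists_ridge_transitionKernel_beta_zero`), giving invariance of `φ̂⁻² Haar^E` on continuous observables, hence
`Kernel.Invariant` (`kernelInvariant_of_forall_continuous`) and the fact (`wilsonMeasureLangevinInvariant_of_kernelInvariant`).
Consequence: `fixedCutoffMixing` — the rung `stub_fixedCutoffMixing` of K_A1 (`fixedCutoffMixing_of_doeblin` with `doeblin_szz`),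
now free of any named-fact hypothesis.  RECORD-rung R3 plumbing (fixed cut-off `K`, `T` after `K`): this is NOT the K-uniform
crux `UniformColdStartMixing`, and the Yang–Mills mass gap is NOT proved here.  No definition, no sorry.
-/

set_option autoImplicit false

noncomputable section

namespace Summit.QuantumFields.YangMills.Theorems.ColdStartUniversality

open MeasureTheory ProbabilityTheory Finset Filter Set
open scoped BigOperators NNReal ENNReal
open Literature.Probability.Process Literature.MathematicalPhysics.QuantumFieldTheory Literature.Analysis.SpecialFunctions
open Literature.MathematicalPhysics.QuantumLattice (fundamentalRep fundamentalLatticeRep continuous_fundamentalRep)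

variable {L : ℕ} [NeZero L]

/-- **The plaquette function on the group is the Wilson action up to an additive constant**:
`ψ̂(coords U) = 2β'·#Plaquettes - β'·wilsonAction(U)` (`rootedLoop_matrixConfig_false`). [folklore] -/
theorem psiV_eq_wilsonAction (β' : ℝ) (U : GaugeConfig 3 L (Matrix.specialUnitaryGroup (Fin 2) ℂ)) :
    β' * ∑ p : Plaquette 3 L, (rootedLoop (fun (e : Edge 3 L) (i j : Fin 2) =>
        ((((fundamentalRep (Fin 2) (U e) : Matrix (Fin 2) (Fin 2) ℂ) i j).re : ℝ) : ℂ) +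
          ((((fundamentalRep (Fin 2) (U e) : Matrix (Fin 2) (Fin 2) ℂ) i j).im : ℝ) : ℂ) * Complex.I)
        (p.1, p.2.1.1) p.2.1.2 false).trace.re =
      2 * β' * Fintype.card (Plaquette 3 L) - β' * wilsonAction (fundamentalRep (Fin 2)) U := by
  classical
  have hM : (fun (e : Edge 3 L) (i j : Fin 2) =>
        ((((fundamentalRep (Fin 2) (U e) : Matrix (Fin 2) (Fin 2) ℂ) i j).re : ℝ) : ℂ) +
          ((((fundamentalRep (Fin 2) (U e) : Matrix (Fin 2) (Fin 2) ℂ) i j).im : ℝ) : ℂ) * Complex.I) =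
      fun e => (fundamentalRep (Fin 2) (U e) : Matrix (Fin 2) (Fin 2) ℂ) := by
    funext e i j
    exact Complex.re_add_im _
  rw [hM]
  have hloop : ∀ p : Plaquette 3 L,
      rootedLoop (fun e => (fundamentalRep (Fin 2) (U e) : Matrix (Fin 2) (Fin 2) ℂ)) (p.1, p.2.1.1) p.2.1.2 false =
      fundamentalRep (Fin 2) (plaquetteHolonomy U p.1 p.2.1.1 p.2.1.2) := fun p =>
    rootedLoop_matrixConfig_false (fundamentalLatticeRep 2) U (p.1, p.2.1.1) p.2.1.2
  simp_rw [hloop]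
  unfold wilsonAction
  rw [Finset.sum_sub_distrib, Finset.sum_const, Finset.card_univ, nsmul_eq_mul]
  push_cast
  ring

/-- **`μ_{β'} ∝ e^{ψ̂} · Haar^E` on observables**: there is a constant `C` with `∫ F dμ_{β'} = C ∫ F e^{ψ̂} dHaar^E` for every `F`.
[folklore] -/
theorem integral_wilsonMeasure_eq_const_mul (β' : ℝ) :
    ∃ C : ℝ, ∀ F : GaugeConfig 3 L (Matrix.specialUnitaryGroup (Fin 2) ℂ) → ℝ,
      ∫ U, F U ∂(wilsonMeasure (d := 3) (L := L) (fundamentalRep (Fin 2)) β') =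
        C * ∫ U, F U * Real.exp (β' * ∑ p : Plaquette 3 L, (rootedLoop (fun (e : Edge 3 L) (i j : Fin 2) =>
          ((((fundamentalRep (Fin 2) (U e) : Matrix (Fin 2) (Fin 2) ℂ) i j).re : ℝ) : ℂ) +
            ((((fundamentalRep (Fin 2) (U e) : Matrix (Fin 2) (Fin 2) ℂ) i j).im : ℝ) : ℂ) * Complex.I)
          (p.1, p.2.1.1) p.2.1.2 false).trace.re)
          ∂(Measure.pi fun _ : Edge 3 L => haarProbability (Matrix.specialUnitaryGroup (Fin 2) ℂ)) := by
  classical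
  haveI := secondCountableTopology_su2
  haveI := borelSpace_config L
  set c0 : ℝ := 2 * β' * Fintype.card (Plaquette 3 L) with hc0
  refine ⟨((partitionFunction (d := 3) (L := L) (fundamentalRep (Fin 2)) β')⁻¹).toReal * Real.exp (-c0), fun F => ?_⟩
  obtain ⟨-, -, hψc, -⟩ := exists_groundState_bounds (L := L) β'
  have hdens : (fun U : GaugeConfig 3 L (Matrix.specialUnitaryGroup (Fin 2) ℂ) =>
      ENNReal.ofReal (Real.exp (-β' * wilsonAction (fundamentalRep (Fin 2)) U))) =
      fun U => ((fun U : GaugeConfig 3 L (Matrix.specialUnitaryGroup (Fin 2) ℂ) =>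
        (Real.exp (-β' * wilsonAction (fundamentalRep (Fin 2)) U)).toNNReal) U : ℝ≥0∞) := rfl
  have hmeas : Measurable fun U : GaugeConfig 3 L (Matrix.specialUnitaryGroup (Fin 2) ℂ) =>
      (Real.exp (-β' * wilsonAction (fundamentalRep (Fin 2)) U)).toNNReal := by
    have heq : (fun U : GaugeConfig 3 L (Matrix.specialUnitaryGroup (Fin 2) ℂ) =>
        Real.exp (-β' * wilsonAction (fundamentalRep (Fin 2)) U)) =
        fun U => Real.exp (β' * ∑ p : Plaquette 3 L, (rootedLoop (fun (e : Edge 3 L) (i j : Fin 2) =>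
          ((((fundamentalRep (Fin 2) (U e) : Matrix (Fin 2) (Fin 2) ℂ) i j).re : ℝ) : ℂ) +
            ((((fundamentalRep (Fin 2) (U e) : Matrix (Fin 2) (Fin 2) ℂ) i j).im : ℝ) : ℂ) * Complex.I)
          (p.1, p.2.1.1) p.2.1.2 false).trace.re - c0) := by
      funext U; rw [psiV_eq_wilsonAction, hc0]; congr 1; ring
    have h1 : Measurable fun U : GaugeConfig 3 L (Matrix.specialUnitaryGroup (Fin 2) ℂ) =>
        Real.exp (-β' * wilsonAction (fundamentalRep (Fin 2)) U) := by
      rw [heq]; exact (Real.continuous_exp.comp (hψc.sub continuous_const)).measurable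
    exact h1.real_toNNReal
  unfold wilsonMeasure wilsonWeight
  rw [integral_smul_measure, hdens, integral_withDensity_eq_integral_smul hmeas, smul_eq_mul, mul_assoc,
    ← integral_const_mul (Real.exp (-c0))]
  congr 1
  refine integral_congr_ae (Eventually.of_forall fun U => ?_)
  dsimp only
  rw [NNReal.smul_def, Real.coe_toNNReal _ (Real.exp_pos _).le, smul_eq_mul, psiV_eq_wilsonAction, hc0]
  rw [show -β' * wilsonAction (fundamentalRep (Fin 2)) U =
      -(2 * β' * Fintype.card (Plaquette 3 L)) + (2 * β' * Fintype.card (Plaquette 3 L) -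
        β' * wilsonAction (fundamentalRep (Fin 2)) U) by ring, Real.exp_add]
  ring

/-- ★ **SZZ Lemma 3.3 for `SU(2)`, `d = 3`, every coupling `β'`**: the Wilson lattice Yang–Mills measure is invariant under the
Shen–Zhu–Zhu lattice Langevin dynamics — the named fact `WilsonMeasureLangevinInvariant (fundamentalLatticeRep 2) 3 L β'` is a
theorem. [cite: ShenZhuZhu2022, §3 Lemma 3.3 (invariance of the lattice Yang–Mills measure; p. 13)] -/
theorem wilsonMeasureLangevinInvariant_su2 (L : ℕ) [NeZero L] (β' : ℝ) :
    WilsonMeasureLangevinInvariant (fundamentalLatticeRep 2) 3 L β' := by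
  classical
  haveI := secondCountableTopology_su2
  haveI := borelSpace_config L
  haveI : IsProbabilityMeasure (haarProbability (Matrix.specialUnitaryGroup (Fin 2) ℂ)) := inferInstance
  obtain ⟨κ, hκ, -, hreal⟩ := exists_transitionKernel L β'
  obtain ⟨κ₀, hκ₀, -, hreal₀⟩ := exists_transitionKernel L 0
  haveI := hκ
  haveI := hκ₀
  set π : Measure (GaugeConfig 3 L (Matrix.specialUnitaryGroup (Fin 2) ℂ)) :=
    Measure.pi fun _ : Edge 3 L => haarProbability (Matrix.specialUnitaryGroup (Fin 2) ℂ) with hπ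
  haveI : IsProbabilityMeasure π := by rw [hπ]; infer_instance
  -- the functions
  let ψV : GaugeConfig 3 L (Matrix.specialUnitaryGroup (Fin 2) ℂ) → ℝ := fun V =>
    β' * ∑ p : Plaquette 3 L, (rootedLoop (fun (e : Edge 3 L) (i j : Fin 2) =>
      ((((fundamentalRep (Fin 2) (V e) : Matrix (Fin 2) (Fin 2) ℂ) i j).re : ℝ) : ℂ) +
        ((((fundamentalRep (Fin 2) (V e) : Matrix (Fin 2) (Fin 2) ℂ) i j).im : ℝ) : ℂ) * Complex.I)
      (p.1, p.2.1.1) p.2.1.2 false).trace.re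
  let Vh : GaugeConfig 3 L (Matrix.specialUnitaryGroup (Fin 2) ℂ) → ℝ := fun V =>
    (let x : (Edge 3 L × Fin 2 × Fin 2 × Bool) → ℝ := fun q =>
        (fun z : ℂ => if q.2.2.2 then z.im else z.re)
          ((fundamentalRep (Fin 2) (V q.1) : Matrix (Fin 2) (Fin 2) ℂ) q.2.1 q.2.2.1)
     let b₀ : (Edge 3 L × Fin 2 × Fin 2 × Bool) → ℝ := fun q =>
        (fun z : ℂ => if q.2.2.2 then z.im else z.re) ((latticeLangevinDynamics (fundamentalLatticeRep 2) 0).drift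
          (matrixConfig (fundamentalRep (Fin 2)) V) q.1 q.2.1 q.2.2.1)
     let σ : (Edge 3 L × Fin 2 × Fin 2 × Bool) → (Edge 3 L × NoiseIdx 2) → ℝ := fun q k =>
        if k.1 = q.1 then (fun z : ℂ => if q.2.2.2 then z.im else z.re)
          ((latticeLangevinDynamics (fundamentalLatticeRep 2) 0).noise
            (matrixConfig (fundamentalRep (Fin 2)) V) q.1 k.2 q.2.1 q.2.2.1) else 0
     let ψ : ((Edge 3 L × Fin 2 × Fin 2 × Bool) → ℝ) → ℝ := fun y =>
        β' * ∑ p : Plaquette 3 L, (rootedLoop (fun (e : Edge 3 L) (i j : Fin 2) =>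
          ((y (e, i, j, false) : ℝ) : ℂ) + ((y (e, i, j, true) : ℝ) : ℂ) * Complex.I) (p.1, p.2.1.1) p.2.1.2 false).trace.re
     1 / 2 * (∑ i, fderiv ℝ ψ x (Pi.single i 1) * b₀ i +
          1 / 2 * ∑ i, ∑ j, fderiv ℝ (fun z => fderiv ℝ ψ z (Pi.single i 1)) x (Pi.single j 1) * ∑ n, σ i n * σ j n) +
        1 / 8 * ∑ i, ∑ j, fderiv ℝ ψ x (Pi.single i 1) * fderiv ℝ ψ x (Pi.single j 1) * ∑ n, σ i n * σ j n)
  let φ : GaugeConfig 3 L (Matrix.specialUnitaryGroup (Fin 2) ℂ) → ℝ := fun V => Real.exp (-(1 / 2 : ℝ) * ψV V)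
  let ρ : GaugeConfig 3 L (Matrix.specialUnitaryGroup (Fin 2) ℂ) → ℝ := fun V => Real.exp (ψV V)
  obtain ⟨-, -, hψc, -⟩ := exists_groundState_bounds (L := L) β'
  have hψVc : Continuous ψV := hψc
  have hφc : Continuous φ := Real.continuous_exp.comp (continuous_const.mul hψVc)
  have hφpos : ∀ V, 0 < φ V := fun V => Real.exp_pos _
  have hρc : Continuous ρ := Real.continuous_exp.comp hψVc
  have hρ0 : ∀ V, 0 ≤ ρ V := fun V => (Real.exp_pos _).le
  have hVc : Continuous Vh := continuous_groundStatePotential (L := L) β'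
  -- the ridge class
  let E : Set (GaugeConfig 3 L (Matrix.specialUnitaryGroup (Fin 2) ℂ) → ℝ) := {F |
    ∃ (ι : Type) (_ : Fintype ι) (c : ι → ℝ) (g : ι → Edge 3 L → Matrix.specialUnitaryGroup (Fin 2) ℂ)
      (m : ι → Edge 3 L → ℕ), ∀ V, F V = ∑ l, c l * ∏ e, gegenbauerSum 1 (m l e)
        (hsForm 2 (fundamentalRep (Fin 2) (g l e)) (fundamentalRep (Fin 2) (V e)) / 2)}
  have hEc : ∀ w ∈ E, Continuous w := by
    rintro w ⟨ι, hι, c, g, m, hw⟩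
    have h : w = fun V => ∑ l, c l * ∏ e, gegenbauerSum 1 (m l e)
        (hsForm 2 (fundamentalRep (Fin 2) (g l e)) (fundamentalRep (Fin 2) (V e)) / 2) := funext hw
    rw [h]
    exact continuous_finsetSum _ fun l _ => continuous_const.mul (continuous_prod_gegenbauer_latitude (L := L) (g l) (m l))
  have hEmul : ∀ w ∈ E, ∀ w' ∈ E, (fun x => w x * w' x) ∈ E := fun w hw w' hw' => exists_ridge_mul hw hw'
  have hET : ∀ w ∈ E, ∀ r : ℝ≥0, (fun x => ∫ y, w y ∂(κ₀ r x)) ∈ E := fun w hw r =>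
    exists_ridge_transitionKernel_beta_zero κ₀ hreal₀ hw r
  have hEd : ∀ G : GaugeConfig 3 L (Matrix.specialUnitaryGroup (Fin 2) ℂ) → ℝ, Continuous G →
      ∀ ε : ℝ, 0 < ε → ∃ w ∈ E, ∀ x, |w x - G x| < ε := by
    intro G hG ε hε
    obtain ⟨ι, hι, c, g, m, h⟩ := exists_ridge_uniform_near (L := L) hG hε
    exact ⟨fun V => ∑ l, c l * ∏ e, gegenbauerSum 1 (m l e)
      (hsForm 2 (fundamentalRep (Fin 2) (g l e)) (fundamentalRep (Fin 2) (V e)) / 2), ⟨ι, hι, c, g, m, fun V => rfl⟩, h⟩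
  -- the integrated Duhamel identity on the ridge class
  have h5 : ∀ w ∈ E, ∀ t : ℝ≥0,
      (∫ x, (∫ y, φ y * w y ∂(κ t x)) * ρ x ∂π) - ∫ x, φ x * w x * ρ x ∂π =
        ∫ r in (0 : ℝ)..(t : ℝ),
          ((∫ x, φ x * Vh x * (∫ y, w y ∂(κ₀ r.toNNReal x)) * ρ x ∂π) -
            ∫ x, (∫ y, φ y * Vh y * (∫ z, w z ∂(κ₀ r.toNNReal y)) ∂(κ ((t : ℝ) - r).toNNReal x)) * ρ x ∂π) := by
    rintro w ⟨ι, hι, c, g, m, hw⟩ t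
    have hfun : w = fun V => ∑ l, c l * ∏ e, gegenbauerSum 1 (m l e)
        (hsForm 2 (fundamentalRep (Fin 2) (g l e)) (fundamentalRep (Fin 2) (V e)) / 2) := funext hw
    rw [hfun]
    have h := integrated_duhamel (L := L) β' κ hreal κ₀ hreal₀ c g m t
    exact h
  -- the Picard step: invariance of `ρ π` on continuous observables
  have hinv := integral_kernel_weighted_eq_of_duhamel π κ κ₀ hρc hρ0 hφc hφpos hVc E hEc hEmul hET hEd h5
  -- the Wilson measure
  obtain ⟨C, hC⟩ := integral_wilsonMeasure_eq_const_mul (L := L) β'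
  refine wilsonMeasureLangevinInvariant_of_kernelInvariant L β' κ hreal fun t => ?_
  refine kernelInvariant_of_forall_continuous L β' (κ t) fun g hg => ?_
  rw [hC, hC]
  congr 1
  exact hinv t g hg

/-- ★ **The rung `stub_fixedCutoffMixing` of crux K_A1 (`UniformColdStartMixing`), UNCONDITIONALLY**: fixed-cut-off
cold-start Cesàro mixing in physical time of Bałaban's block-averaged loop observables for the SU(2) SZZ dynamics, with the
horizon `T` chosen after `K` — `fixedCutoffMixing_of_doeblin` with both walls supplied: (D) `doeblin_szz`, (Inv)
`wilsonMeasureLangevinInvariant_su2`.  RECORD-rung R3 plumbing; not the K-uniform crux, not the mass gap.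
[cite: HairerMattingly2011, Theorems 1.2 and 1.3] -/
theorem fixedCutoffMixing :
    ∀ (F : Balaban1983to89.T3ContinuumYM3Torus.T3Family) (γ : ℝ), 0 < γ →
      ∀ (os : List (Balaban1983to89.T3ContinuumYM3Torus.ULoop3 F)) (δ : ℝ), 0 < δ → ∀ K : ℕ, ∃ T : ℝ, 0 < T ∧
        ∀ (Ω : Type) (mΩ : MeasurableSpace Ω) (P : Measure Ω) (hP : IsProbabilityMeasure P)
          (W : ℝ≥0 → Ω → (Edge 3 ((F.P K).sitesPerDir 0) × NoiseIdx 2 → ℝ)) (hW : IsFlatBrownian W P)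
          (U : ℝ≥0 → Ω → GaugeConfig 3 ((F.P K).sitesPerDir 0) (Matrix.specialUnitaryGroup (Fin 2) ℂ)),
          (∀ ω, U 0 ω = fun _ => 1) →
          (latticeLangevinDynamics (fundamentalLatticeRep 2) ((γ * (F.P K).eps)⁻¹ / 2)).IsSolution
            (fundamentalRep (Fin 2)) hW.natFiltration P W U →
          |(F.scheme (Balaban1983to89.ExpMeanLog.expMeanLogSU :
                Balaban1983to89.LoopAverage (Matrix.specialUnitaryGroup (Fin 2) ℂ)) γ).expectAt K os -
              T⁻¹ * ∫ s in (0 : ℝ)..T, (∫ ω, (os.map fun C => F.avgObs (Balaban1983to89.ExpMeanLog.expMeanLogSU :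
                  Balaban1983to89.LoopAverage (Matrix.specialUnitaryGroup (Fin 2) ℂ)) K C
                (fun b : Balaban1983to89.PBond (F.P K) 0 => U (s / (F.P K).eps).toNNReal ω (b.src, b.dir))).prod ∂P)| ≤ δ :=
  fixedCutoffMixing_of_doeblin (fun _ _ β' κ _ hreal => doeblin_szz β' κ hreal)
    (fun L _ β' => wilsonMeasureLangevinInvariant_su2 L β')

end Summit.QuantumFields.YangMills.Theorems.ColdStartUniversality

end
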